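import Mathlib.NumberTheory.GaussSum
import Mathlib.Analysis.SpecialFunctions.Complex.CircleAddChar
import HarnessLib

/-!
# van Dam–Seroussi, Algorithm 1: the character state is an eigenvector of `χ² ∘ 𝓕_β`

Topic `Literature/Computability/Cryptography`, companion of `VanDamSeroussiGaussSums.lean` (the named
fact `VanDamSeroussi2002_gaussSumPhase_qsolvable`, van Dam–Seroussi 2002, Thm. 1). This file PROVES the
number-theoretic heart of the algorithm — everything in [VanDamSeroussi2002, §2.1 and §4] that does
not mention a quantum circuit — over Mathlib's `gaussSum`, `MulChar`, `ZMod.stdAddChar`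
(`e(x) = exp(2πi x/p)`), for the prime field `𝔽_p = ZMod p`:

* `sum_mulChar_mul_stdAddChar` — **Fact 1** (§2.1): `Σ_x χ(x) e(c x) = χ⁻¹(c) · G(χ, e)` for every
  `c` (for `c = 0` both sides vanish because `χ ≠ 1`);
* `norm_gaussSum_stdAddChar`, `norm_gaussSum_mulShift` — `|G(𝔽_p, χ, β)| = √p` for `χ ≠ 1`, `β ≠ 0`
  (§2.1, last paragraph), hence the eigenvalue `G/√p` has modulus one
  (`norm_gaussSum_mulShift_div_sqrt`);
* `fourier β f` — the Fourier transform `𝓕_β : |x⟩ ↦ p^{-1/2} Σ_y e(β x y)|y⟩` of §3.1, Fact 4, as an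
  operator on amplitude functions `ZMod p → ℂ`, and **Algorithm 1** (§4):
  `fourier_mulChar` — `𝓕_β |χ⟩ = (G(χ, e_β)/√p) · |χ⁻¹⟩` ("the expression between the big parentheses
  equals `G(𝔽_p, χ, βy) = χ(y⁻¹) G(𝔽_p, χ, β)` for `y ≠ 0` and is zero if `y = 0`"), and
  `mulChar_sq_mul_fourier_mulChar` — after the phase change `|y⟩ ↦ χ²(y)|y⟩` one is back at `|χ⟩`
  with the overall phase `G(χ, e_β)/√p`: `χ(y)² · (𝓕_β χ)(y) = (G/√p) · χ(y)`;
* `sum_norm_sq_mulChar` — `Σ_x |χ(x)|² = p − 1` (the normalisation `1/√(p−1)` of `|χ⟩`, §3.2);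
* `sum_range_mul_exp_eq_gaussSum` — the explicit exponential sum in the statement of
  `VanDamSeroussi2002_gaussSumPhase_qsolvable`, `Σ_{z<p} χ(z) exp(2πi (b z)/p)`, IS
  `gaussSum χ (e.mulShift b)`.

Everything here is proved; the one definition (`fourier`) has a body; no named fact is introduced.

## References

* W. van Dam, G. Seroussi, *Efficient quantum algorithms for estimating Gauss sums*,
  arXiv:quant-ph/0207131 (2002), §2.1 (Def. 1, Fact 1, `|G| = √(p^r)`), §3.1 (Fact 4), §4
  (Algorithm 1, Theorem 1) [VanDamSeroussi2002].
* K. Ireland, M. Rosen, *A Classical Introduction to Modern Number Theory*, GTM 84, Prop. 8.2.2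
  (`|g(χ)| = √p`) [IrelandRosen1990].
-/

noncomputable section

namespace Literature.Computability.Cryptography

namespace VanDamSeroussi

open Complex Finset

variable {p : ℕ} [hp : Fact p.Prime]

/-! ### Fact 1: twisting the additive character -/

/-- **Fact 1** of [VanDamSeroussi2002, §2.1], prime-field case, including the degenerate twist:
`Σ_x χ(x) e(c·x) = χ⁻¹(c) · G(χ, e)` for a non-trivial `χ` and every `c ∈ 𝔽_p` (for a unit `c` this
is Mathlib's `gaussSum_mulShift_eq`; for `c = 0` the left side is `Σ_x χ(x) = 0`).
[cite: VanDamSeroussi2002, §2.1 Fact 1] -/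
theorem sum_mulChar_mul_stdAddChar {χ : MulChar (ZMod p) ℂ} (hχ : χ ≠ 1) (c : ZMod p) :
    ∑ x : ZMod p, χ x * ZMod.stdAddChar (c * x) = χ⁻¹ c * gaussSum χ ZMod.stdAddChar := by
  have h : ∑ x : ZMod p, χ x * ZMod.stdAddChar (c * x) = gaussSum χ (ZMod.stdAddChar.mulShift c) := by
    simp only [gaussSum, AddChar.mulShift_apply]
  rw [h]
  by_cases hc : IsUnit c
  · exact gaussSum_mulShift_eq χ _ hc.unit
  · have hc0 : c = 0 := by
      contrapose! hc
      exact isUnit_iff_ne_zero.mpr hc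
    rw [MulChar.map_nonunit _ hc, zero_mul, hc0, AddChar.mulShift_zero, gaussSum_one_right hχ]

/-- The twisted Gauss sum `G(χ, e_b) = χ⁻¹(b) G(χ, e)` for every `b` (Fact 1 with `δ = 1`).
[cite: VanDamSeroussi2002, §2.1 Fact 1] -/
theorem gaussSum_mulShift_eq_inv_mul {χ : MulChar (ZMod p) ℂ} (hχ : χ ≠ 1) (b : ZMod p) :
    gaussSum χ (ZMod.stdAddChar.mulShift b) = χ⁻¹ b * gaussSum χ ZMod.stdAddChar := by
  rw [← sum_mulChar_mul_stdAddChar hχ b]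
  simp only [gaussSum, AddChar.mulShift_apply]

/-! ### The modulus of a Gauss sum -/

/-- `|G(𝔽_p, χ, 1)| = √p` for a non-trivial character. [cite: VanDamSeroussi2002, §2.1 (|G| = √(p^r))] -/
theorem norm_gaussSum_stdAddChar {χ : MulChar (ZMod p) ℂ} (hχ : χ ≠ 1) :
    ‖gaussSum χ (ZMod.stdAddChar (N := p))‖ = Real.sqrt p := by
  have h : gaussSum χ (ZMod.stdAddChar (N := p)) * (starRingEnd ℂ) (gaussSum χ ZMod.stdAddChar) = p := by
    rw [starRingEnd_apply, star_gaussSum_eq,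
      gaussSum_mul_gaussSum_eq_card hχ (ZMod.isPrimitive_stdAddChar p), ZMod.card]
  rw [Complex.mul_conj] at h
  have h2 : Complex.normSq (gaussSum χ (ZMod.stdAddChar (N := p))) = p := by exact_mod_cast h
  rw [← Real.sqrt_sq (norm_nonneg _), ← Complex.normSq_eq_norm_sq, h2]

/-- The values of a multiplicative character of `𝔽_p` at units have modulus one. [folklore] -/
theorem norm_mulChar_apply_of_isUnit (χ : MulChar (ZMod p) ℂ) {x : ZMod p} (hx : IsUnit x) :
    ‖χ x‖ = 1 := by
  have hfin : ((χ x) ^ (Fintype.card (ZMod p)ˣ)) = 1 := by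
    rw [← map_pow, ← hx.unit_spec, ← Units.val_pow_eq_pow_val, pow_card_eq_one, Units.val_one, map_one]
  exact Complex.norm_eq_one_of_pow_eq_one hfin Fintype.card_ne_zero

/-- `|G(𝔽_p, χ, β)| = √p` for a non-trivial character `χ` and `β ≠ 0`.
[cite: VanDamSeroussi2002, §2.1 (|G(F_{p^r}, χ, β)| = √(p^r))] -/
theorem norm_gaussSum_mulShift {χ : MulChar (ZMod p) ℂ} (hχ : χ ≠ 1) {b : ZMod p} (hb : b ≠ 0) :
    ‖gaussSum χ (ZMod.stdAddChar.mulShift b)‖ = Real.sqrt p := by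
  rw [gaussSum_mulShift_eq_inv_mul hχ, norm_mul, norm_gaussSum_stdAddChar hχ,
    norm_mulChar_apply_of_isUnit _ (isUnit_iff_ne_zero.mpr hb), one_mul]

/-- The Gauss sum of a non-trivial character with a non-trivial twist is non-zero. [cite: VanDamSeroussi2002, §2.1] -/
theorem gaussSum_mulShift_ne_zero {χ : MulChar (ZMod p) ℂ} (hχ : χ ≠ 1) {b : ZMod p} (hb : b ≠ 0) :
    gaussSum χ (ZMod.stdAddChar.mulShift b) ≠ 0 := by
  intro h
  have h' := norm_gaussSum_mulShift hχ hb
  rw [h, norm_zero] at h'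
  have : (0 : ℝ) < Real.sqrt p := Real.sqrt_pos.2 (by exact_mod_cast hp.out.pos)
  linarith

/-- **The eigenvalue has modulus one**: `|G(𝔽_p, χ, β)/√p| = 1`, i.e. `G = √p · e^{iγ}`
(Def. 2 of the Gauss Sum Problem). [cite: VanDamSeroussi2002, §2.2 Def. 2] -/
theorem norm_gaussSum_mulShift_div_sqrt {χ : MulChar (ZMod p) ℂ} (hχ : χ ≠ 1) {b : ZMod p} (hb : b ≠ 0) :
    ‖gaussSum χ (ZMod.stdAddChar.mulShift b) / (Real.sqrt p : ℂ)‖ = 1 := by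
  have hs : (0 : ℝ) < Real.sqrt p := Real.sqrt_pos.2 (by exact_mod_cast hp.out.pos)
  rw [norm_div, norm_gaussSum_mulShift hχ hb, Complex.norm_real, Real.norm_of_nonneg hs.le, div_self hs.ne']

/-! ### The normalisation of the character state -/

/-- `Σ_x |χ(x)|² = p − 1`: the state `|χ⟩ = (p−1)^{-1/2} Σ_x χ(x)|x⟩` of §3.2 is a unit vector.
[cite: VanDamSeroussi2002, §3.2 (Lemma 1)] -/
theorem sum_norm_sq_mulChar (χ : MulChar (ZMod p) ℂ) :
    ∑ x : ZMod p, ‖χ x‖ ^ 2 = (p : ℝ) - 1 := by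
  have h : ∀ x : ZMod p, ‖χ x‖ ^ 2 = if x = 0 then 0 else 1 := by
    intro x
    by_cases hx : x = 0
    · rw [if_pos hx, hx, MulChar.map_zero, norm_zero]; ring
    · rw [if_neg hx, norm_mulChar_apply_of_isUnit χ (isUnit_iff_ne_zero.mpr hx), one_pow]
  simp_rw [h]
  rw [Finset.sum_ite, Finset.sum_const_zero, zero_add, Finset.sum_const, nsmul_eq_mul, mul_one]
  rw [Finset.filter_ne' Finset.univ (0 : ZMod p), Finset.card_erase_of_mem (Finset.mem_univ _),
    Finset.card_univ, ZMod.card]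
  have := hp.out.one_le
  push_cast [Nat.cast_sub this]
  ring

/-! ### The Fourier transform `𝓕_β` and Algorithm 1 -/

/-- **The quantum Fourier transform `𝓕_β` over `𝔽_p`** [VanDamSeroussi2002, §3.1 Fact 4]
(`|x⟩ ↦ p^{-1/2} Σ_y e(β x y)|y⟩`), as the operator on amplitude functions:
`(𝓕_β f)(y) = p^{-1/2} Σ_x f(x) e(β x y)`. [cite: VanDamSeroussi2002, §3.1 Fact 4] -/
def fourier (b : ZMod p) (f : ZMod p → ℂ) : ZMod p → ℂ :=
  fun y => (Real.sqrt p : ℂ)⁻¹ * ∑ x : ZMod p, f x * ZMod.stdAddChar (b * x * y)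

/-- Unfolding `fourier`. [cite: VanDamSeroussi2002, §3.1 Fact 4] -/
theorem fourier_apply (b : ZMod p) (f : ZMod p → ℂ) (y : ZMod p) :
    fourier b f y = (Real.sqrt p : ℂ)⁻¹ * ∑ x : ZMod p, f x * ZMod.stdAddChar (b * x * y) := rfl

/-- **Algorithm 1, first half** [VanDamSeroussi2002, §4]: the Fourier transform of the character
state is the conjugate character state times the normalised Gauss sum,
`𝓕_β |χ⟩ = (G(𝔽_p, χ, β)/√p) · |χ⁻¹⟩`, i.e. `(𝓕_β χ)(y) = (G/√p) χ⁻¹(y)` for every `y`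
(the coefficient `Σ_x χ(x) e(βxy) = G(χ, βy)` equals `χ(y⁻¹) G(χ, β)` for `y ≠ 0` and `0` for
`y = 0`). [cite: VanDamSeroussi2002, §4 Algorithm 1 (proof)] -/
theorem fourier_mulChar {χ : MulChar (ZMod p) ℂ} (hχ : χ ≠ 1) (b y : ZMod p) :
    fourier b χ y = gaussSum χ (ZMod.stdAddChar.mulShift b) / (Real.sqrt p : ℂ) * χ⁻¹ y := by
  rw [fourier_apply]
  have h : ∑ x : ZMod p, χ x * ZMod.stdAddChar (b * x * y) = χ⁻¹ y * gaussSum χ (ZMod.stdAddChar.mulShift b) := by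
    have h1 : ∑ x : ZMod p, χ x * ZMod.stdAddChar (b * x * y) = ∑ x : ZMod p, χ x * ZMod.stdAddChar (b * y * x) := by
      refine Finset.sum_congr rfl fun x _ => ?_
      congr 2; ring
    rw [h1, sum_mulChar_mul_stdAddChar hχ (b * y), gaussSum_mulShift_eq_inv_mul hχ b, map_mul]
    ring
  rw [h]
  ring

/-- **Algorithm 1** [VanDamSeroussi2002, §4]: after the phase change `|y⟩ ↦ χ²(y)|y⟩` the
Fourier-transformed character state is the character state again, with the overall phase
`G(𝔽_p, χ, β)/√p`: `χ(y)² · (𝓕_β χ)(y) = (G/√p) · χ(y)` for every `y` — `|χ⟩` is an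
eigenvector of `χ² ∘ 𝓕_β` with eigenvalue `G(𝔽_p, χ, β)/√p = e^{iγ}`.
[cite: VanDamSeroussi2002, §4 Algorithm 1] -/
theorem mulChar_sq_mul_fourier_mulChar {χ : MulChar (ZMod p) ℂ} (hχ : χ ≠ 1) (b y : ZMod p) :
    χ y ^ 2 * fourier b χ y = gaussSum χ (ZMod.stdAddChar.mulShift b) / (Real.sqrt p : ℂ) * χ y := by
  rw [fourier_mulChar hχ]
  by_cases hy : IsUnit y
  · have hne : χ y ≠ 0 := fun h0 => by
      have := norm_mulChar_apply_of_isUnit χ hy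
      rw [h0, norm_zero] at this
      exact zero_ne_one this
    rw [MulChar.inv_apply_eq_inv' χ y]
    field_simp
  · rw [MulChar.map_nonunit χ hy, MulChar.map_nonunit χ⁻¹ hy]
    ring

/-- The same, as an identity of amplitude functions: `χ² · 𝓕_β χ = (G/√p) • χ`.
[cite: VanDamSeroussi2002, §4 Algorithm 1] -/
theorem mulChar_sq_mul_fourier_mulChar_funext {χ : MulChar (ZMod p) ℂ} (hχ : χ ≠ 1) (b : ZMod p) :
    (fun y => χ y ^ 2 * fourier b χ y) =
      (gaussSum χ (ZMod.stdAddChar.mulShift b) / (Real.sqrt p : ℂ)) • (χ : ZMod p → ℂ) := by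
  funext y
  rw [mulChar_sq_mul_fourier_mulChar hχ, Pi.smul_apply, smul_eq_mul]

/-! ### The explicit exponential sum of the named fact -/

/-- The exponential sum in `VanDamSeroussi2002_gaussSumPhase_qsolvable`,
`Σ_{z<p} χ(z) exp(2πi (b z)/p)`, is the Gauss sum `gaussSum χ (e.mulShift b)` of Mathlib
(`e = ZMod.stdAddChar`). [cite: VanDamSeroussi2002, §2.1 Def. 1] -/
theorem sum_range_mul_exp_eq_gaussSum (χ : MulChar (ZMod p) ℂ) (b : ℕ) :
    ∑ z ∈ Finset.range p, χ (z : ZMod p) * Complex.exp (2 * Real.pi * Complex.I * ((b * z : ℕ) : ℂ) / (p : ℂ)) =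
      gaussSum χ (ZMod.stdAddChar.mulShift (b : ZMod p)) := by
  unfold gaussSum
  refine Finset.sum_nbij' (fun z : ℕ => (z : ZMod p)) ZMod.val (fun _ _ => Finset.mem_univ _)
    (fun a _ => Finset.mem_range.mpr (ZMod.val_lt a))
    (fun z hz => ZMod.val_natCast_of_lt (Finset.mem_range.mp hz))
    (fun a _ => ZMod.natCast_zmod_val a) (fun z _ => ?_)
  rw [AddChar.mulShift_apply, ← Nat.cast_mul, ZMod.stdAddChar_apply, ZMod.toCircle_natCast]

end VanDamSeroussi

end Literature.Computability.Cryptography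

end
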